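import Summits.BirchSwinnertonDyer.BirchSwinnertonDyer.Theorems.TwoAdicConverseOrdLambdaHalfAtTwoGreenbergCotorsionOrderTwo
import Literature.NumberTheory.GaloisRepresentations.CyclotomicTowerLocalIndex
import HarnessLib

/-!
# Route `TwoAdicConverse` (rung S3), crux `OrdLambdaHalfAtTwo` (item stmt-BirchSwinnertonDyer-19556), line
# `kato-determinant-greenberg-two`: B2 over the CYCLOTOMIC `ℤ₂`-tower of the Greenberg field — the decomposition clause
# discharged («no finite place splits completely in the cyclotomic `ℤ_p`-extension»)

Cell `bsd-2adic`, seat `bsd-2adic-conv-1` GEN 24 (`--supports` stmt-BirchSwinnertonDyer-19556; helper; route-independent imports).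
Third file of the B2 spine (after `…GreenbergCotorsionOfResidual` p658418 and `…GreenbergCotorsionOrderTwo` p658794).  The residual
dévissage theorems carry the hypothesis `¬ (decomp w ≤ ker κ)` («`w` is finitely decomposed in `K_∞`»).  For the CYCLOTOMIC
`ℤ_p`-extension of ANY number field and ANY finite place this holds: the `p`-adic cyclotomic character has a value of infinite
order on every decomposition group (tree `GaloisRepresentations.exists_cyclotomicCharacter_resGal_not_mem_torsion`; Washington §13.1
«no finite place splits completely in the cyclotomic `ℤ_p`-extension»; Greenberg LNM 1716 §1), while `ker κ = χ_p⁻¹(μ(ℤ_p))` for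
`κ` cyclotomic.  Hence:

* `not_decomp_le_kerSubgroup_of_isCyclotomic` — for `κ` cyclotomic and every finite place `v`: `¬ (decomp v ≤ ker κ)`;
* **`greenbergStrictSelmerDual_finite_torsion_mu_of_residual_cyclotomic_two`** — B2 (the Greenberg strict-at-`w`/relaxed dual
  of `E[2^∞]` is `Λ`-finitely generated, `Λ`-TORSION, `μ = 0`) over the cyclotomic `ℤ₂`-tower of `K`, for a curve `V/K`, a place
  `w ∣ 2`, a `Γ_K`-stable LINE `Φ ≤ V[2]`, from the SINGLE residual input «`R_w^Σ(K_∞, Φ)` finite» (`Σ ⊇` the bad places prime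
  to `2`).  For the line's habitat (β): `V = W.baseChange K`, `Φ` = the line of the rational `2`-torsion point, `Φ ≅ 𝔽₂` trivial,
  and the input is the classical statement «the maximal abelian pro-`2` extension of `K^{cyc}_∞` unramified outside `Σ ∪ {w̄}` and
  split at `w` has finitely many quadratic subextensions» (NOT stated or proved here).

HONEST FRAMING.  Composition of tree theorems; no named fact, no definition, no `sorry`; BSD is not proved by any of this.
PARTITION (D-0054): none — RANK axis S3 × X5@2 stratum (β).

References: L. Washington, *Introduction to Cyclotomic Fields* §13.1 [Washington1997]; R. Greenberg, LNM 1716 (1999) §1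
[GreenbergLNM1716]; F. Castella, G. Grossi, J. Lee, C. Skinner, Invent. Math. 227 (2022) §1.4 [CastellaGrossiLeeSkinner2022].
-/

set_option linter.dupNamespace false
set_option autoImplicit false

noncomputable section

open scoped Classical

namespace Summit.BirchSwinnertonDyer.BirchSwinnertonDyer.Theorems.TwoAdicGreenbergCotorsion

open NumberField IsDedekindDomain Field WeierstrassCurve
open Literature.NumberTheory.EllipticCurves Literature.NumberTheory.EllipticCurves.GreenbergSelmer
  Literature.NumberTheory.EllipticCurves.GreenbergVatsal2000 Literature.NumberTheory.GaloisRepresentations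
  Summit.BirchSwinnertonDyer.Rank1Residual.X11b Summit.BirchSwinnertonDyer.Rank1Residual.X11b.AcSelmer
  Summit.BirchSwinnertonDyer.Rank1Residual.X2.ResidualDevissageModules

variable {K : Type} [Field K] [NumberField K]

/-- **No finite place splits completely in the cyclotomic `ℤ_p`-extension**: for `κ` the cyclotomic `ℤ_p`-extension of a
number field `K` (`ker κ = χ_p⁻¹(μ(ℤ_p))`) and any finite place `v`, the decomposition group `D_v` (tree's chosen embedding,
`GreenbergSelmer.decomp v`) is NOT contained in `Gal(K̄/K_∞) = ker κ`: some `σ ∈ Γ_{K_v}` has `χ_p(σ|_{K̄})` of infinite order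
(`exists_cyclotomicCharacter_resGal_not_mem_torsion`). [cite: Washington1997, §13.1] [cite: GreenbergLNM1716, §1] -/
theorem not_decomp_le_kerSubgroup_of_isCyclotomic {p : ℕ} [Fact p.Prime] (κ : ZpExtension K p)
    (hκ : κ.IsCyclotomic) (v : HeightOneSpectrum (𝓞 K)) : ¬ (GreenbergSelmer.decomp v ≤ κ.kerSubgroup) := by
  intro hD
  obtain ⟨σ, hσ⟩ := exists_cyclotomicCharacter_resGal_not_mem_torsion K p v
  have hmem : absGaloisRestrict K (v.adicCompletion K) σ ∈ GreenbergSelmer.decomp v :=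
    (GreenbergSelmer.mem_decomp_iff v _).2 ⟨σ, rfl⟩
  have hker := hD hmem
  unfold ZpExtension.IsCyclotomic at hκ
  rw [hκ, Subgroup.mem_comap] at hker
  exact hσ hker

variable (V : WeierstrassCurve K) [V.IsElliptic]

/-- **B2 over the cyclotomic `ℤ₂`-tower from ONE residual input.**  For an elliptic curve `V/K`, the cyclotomic `ℤ₂`-extension `κ`
of `K` with a topological generator `γ`, a place `w ∣ 2`, a set `Σ` containing the bad places prime to `2`, and a `Γ_K`-stable
LINE `Φ ≤ V[2]` whose residual Castella Selmer group `R_w^Σ(K_∞, Φ)` is finite: every Pontryagin-dual datum `D` of the Greenberg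
(strict at `w`, relaxed elsewhere above `2`) Selmer group of `V[2^∞]` over `K_∞` has `D.X` finitely generated over `Λ = ℤ₂⟦T⟧`,
`Λ`-torsion, and `μ(D.X) = 0`.  [cite: CastellaGrossiLeeSkinner2022, §1.4 Props. 17–18] [cite: GreenbergLNM1716, §1 p. 60] -/
theorem greenbergStrictSelmerDual_finite_torsion_mu_of_residual_cyclotomic_two (κ : ZpExtension K 2)
    (hκ : κ.IsCyclotomic) {γ : absoluteGaloisGroup K} (hγ : κ.IsTopGenerator γ)
    {w : HeightOneSpectrum (𝓞 K)} (hw : ((2 : ℕ) : 𝓞 K) ∈ w.asIdeal)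
    {S : Set (HeightOneSpectrum (𝓞 K))}
    (hS : ∀ v : HeightOneSpectrum (𝓞 K), v ∉ S → ((2 : ℕ) : 𝓞 K) ∉ v.asIdeal → V.HasGoodReductionAt v)
    (Φ : StableSubgroup (absoluteGaloisGroup K) (V.geomTorsion (2 : ℤ))) (hΦ2 : Nat.card Φ.Sub = 2)
    (hΦ : (datumStrictSelmer κ.kerSubgroup Φ.Sub 2 (AcSelmer.bdpData Φ.Sub 2 w) S :
      Set (Literature.NumberTheory.EllipticCurves.subgroupH1 κ.kerSubgroup Φ.Sub)).Finite)
    (D : V.GreenbergStrictSelmerDualData κ γ (AcSelmer.bdpData _ 2 w)) :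
    Module.Finite (IwasawaAlgebra 2) D.X ∧ Module.IsTorsion (IwasawaAlgebra 2) D.X ∧ muInvariant 2 D.X = 0 :=
  greenbergStrictSelmerDual_finite_torsion_mu_of_residual_line_two V κ hγ hw
    (not_decomp_le_kerSubgroup_of_isCyclotomic κ hκ w) hS Φ hΦ2 hΦ D

end Summit.BirchSwinnertonDyer.BirchSwinnertonDyer.Theorems.TwoAdicGreenbergCotorsion

end
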